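import Summits.Ventures.GridStability.Lyapunov.StructurePreservingSwitchExist
import HarnessLib

/-!
# GridStability/Lyapunov/StructurePreservingSwitchRoa — switching certificate, file 3: the energy
# budget of the pre-switch state and RE-SYNCHRONISATION of the post-switch motion inside
# Vu–Turitsyn's polytope (simulation-free contingency certificate, MODEL MV-3)

Cell `gridfusion` (LADDER-GRIDFUSION), seat gridfusion-lyap-1 (g9), line «G2.b-NE39SP-N1-SWITCH»; files 1–2
are `StructurePreservingSwitchKit.lean` (certificate `Switch.Cert`, decidable `Cert.check`) and
`StructurePreservingSwitchExist.lean` (`exists_equilibrium_of_check`). MODEL MV-3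
(`plan/MODEL-VALIDITY.md`; model-2's `StructurePreserving.Params` on an indexed edge list).

THE SITUATION [cite: VuTuritsyn2016, §VI («contingency screening»: the post-fault dynamics is certified
if the cleared state lies in the polytope `𝒫` with `V < V_min`)]: a network with couplings `w0` sits at
its synchronous state `(δ₀, δ̇ = 0)`, `δ₀ = halfAngle t0`, injections `P⁰ = f⁰(δ₀)`; at `t = 0` the
couplings switch to `w1` (a branch opened / closed / re-dispatched impedance) while `P⁰`, the inertias
and the damping / load-frequency coefficients are KEPT. WHAT IS PROVED (any `n`, `m`, data, `D`):
* `potential_pre_le_of_check` — the ENERGY BUDGET: for any post-switch angle vector `θ` within `R` of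
  the certificate's half-angle point, `W¹(θ; δ₀) ≤ c` (Bregman term `≤ Δ²/2`, model-2's
  `branchEnergy_le_sq_half`; `|Δₑ| ≤ 2|dₑ| + 2R` by the tangent subtraction formula and `|arctan d| ≤ |d|`);
* **`resync_of_check`** — for well-formed post-switch data `p` (`p.b` from `w1`, `p.P0 = f⁰(δ₀)`) and
  ANY exact post-switch equilibrium `θ` enclosed as in `exists_equilibrium_of_check`: EVERY solution
  `δ` of `p` AS PRINTED (model-2's `IsSolution`, all `t`) with `δ(0) = δ₀` and zero generator frequency
  deviations at `t = 0` keeps, for all `t ≥ 0`, Vu–Turitsyn's polytope `|(δᵢ − δⱼ) + (θᵢ − θⱼ)| < π` on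
  coupled pairs and `V(θ; δ(t), δ̇(t)) ≤ c`, and converges: `δ(t) → θ + κ·1` with the explicit leaf
  shift `κ = Σ Dᵢ(δ₀ᵢ − θᵢ)/Σ Dᵢ` (the rotation of `θ` on the momentum leaf of the initial state), every
  generator frequency deviation `δ̇ᵢ(t) → 0` — this seat's `tendsto_of_isSolution_vt` (★★ #91) with connectivity from `preconnected_of_coercive`, the level from `levelFactor_le_vtGap`;
* `switch_resync_of_check` — existence and re-synchronisation packaged in one statement.
THREE COLUMNS: CERTIFIED = these implications for MODEL MV-3 (lossless, constant voltage magnitudes,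
frequency-dependent loads, classical machines; switching without fault, no reclosure logic, no
protection); nothing here says any grid is stable or secure. No definition; no named fact; standard
axioms.
-/

noncomputable section

open Set Filter Topology Real Finset
open Summit.Ventures.GridStability.Models.StructurePreserving
open Summit.Ventures.GridStability.Models.StructurePreserving.Params
open Literature.MathematicalPhysics.PowerSystems

namespace Summit.Ventures.GridStability.Lyapunov.StructurePreserving.Switch

variable {n m : ℕ}

/-! ### The energy budget of the pre-switch state -/

section Budget

variable {src tgt : Fin m → Fin n} {w0 w1 : Fin m → ℚ} {t0 : Fin n → ℚ} {r : Fin n} {C : Cert n m}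

/-- **Energy budget.** If the certificate passes the check, then for the post-switch couplings
`p.b = symmetrize (edgeWeight src tgt w1)` and ANY angle vector `θ` with `|θᵢ − θ̃ᵢ| < R`
(`θ̃ = halfAngle t1`), the potential energy of the pre-switch state `δ₀ = halfAngle t0` relative to `θ`
satisfies `W(θ; δ₀) ≤ c`: termwise `U ≤ Δ²/2` (model-2's `branchEnergy_le_sq_half`), the edge-list
double-sum identity, and per coupled edge `|Δₑ| ≤ 2|quot q⁰ₑ q¹ₑ| + 2R` (tangent subtraction formula,
`|arctan d| ≤ |d|`, the enclosure twice). [folklore] -/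
theorem potential_pre_le_of_check (hchk : C.check src tgt w0 w1 t0 r) {p : Params n}
    (hb : p.b = symmetrize (edgeWeight src tgt fun e => (w1 e : ℝ)))
    {θ : Fin n → ℝ} (hθR : ∀ i, |θ i - halfAngle (fun i => (C.t1 i : ℝ)) i| < (C.R : ℝ)) :
    p.potential θ (halfAngle fun i => (t0 i : ℝ)) ≤ (C.c : ℝ) := by
  obtain ⟨⟨hR, -, -, -, -, -⟩, hedge, -, -, hener⟩ := hchk
  set W1 : Fin m → ℝ := fun e => (w1 e : ℝ) with hW1
  set T1 : Fin n → ℝ := fun i => (C.t1 i : ℝ) with hT1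
  set T0 : Fin n → ℝ := fun i => (t0 i : ℝ) with hT0
  have hW1nn : ∀ e, 0 ≤ W1 e := fun e => by simp only [hW1]; exact_mod_cast (hedge e).2.1
  have hbnn : ∀ i j, 0 ≤ p.b i j := fun i j => by
    rw [hb]; exact symmetrize_nonneg (edgeWeight_nonneg hW1nn) i j
  set F : Fin n → Fin n → ℝ :=
    fun i j => ((halfAngle T0 i - halfAngle T0 j) - (θ i - θ j)) ^ 2 / 2 with hF
  have hFs : ∀ i j, F i j = F j i := fun i j => by simp only [hF]; ring
  -- step 1: Bregman term ≤ Δ²/2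
  have h1 : p.potential θ (halfAngle T0) ≤ 1 / 2 * ∑ i, ∑ j, p.b i j * F i j := by
    unfold Params.potential
    refine mul_le_mul_of_nonneg_left (Finset.sum_le_sum fun i _ => Finset.sum_le_sum fun j _ =>
      mul_le_mul_of_nonneg_left ?_ (hbnn i j)) (by norm_num)
    exact branchEnergy_le_sq_half _ _
  -- step 2: edge-list form
  have h2 : 1 / 2 * ∑ i, ∑ j, p.b i j * F i j = ∑ e, W1 e * F (src e) (tgt e) := by
    rw [hb]; exact half_sum_symmetrize src tgt W1 F hFs
  -- step 3: per-edge bound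
  have h3 : ∀ e, W1 e * F (src e) (tgt e) ≤ W1 e * (2 * (|quot (quot (T0 (src e)) (T0 (tgt e)))
      (quot (T1 (src e)) (T1 (tgt e)))| + (C.R : ℝ)) ^ 2) := by
    intro e
    by_cases hwe : w1 e = 0
    · have : W1 e = 0 := by simp [hW1, hwe]
      rw [this, zero_mul, zero_mul]
    obtain ⟨hp1, -, hp0, -, hpq, -⟩ := (hedge e).2.2.2.resolve_left hwe
    refine mul_le_mul_of_nonneg_left ?_ (hW1nn e)
    have hp0' : (-1 : ℝ) < T0 (src e) * T0 (tgt e) := by simp only [hT0]; exact_mod_cast hp0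
    have hp1' : (-1 : ℝ) < T1 (src e) * T1 (tgt e) := by simp only [hT1]; exact_mod_cast hp1
    have hpq' : (-1 : ℝ) < quot (T0 (src e)) (T0 (tgt e)) * quot (T1 (src e)) (T1 (tgt e)) := by
      have := (Rat.cast_lt (K := ℝ)).2 hpq
      rw [Rat.cast_mul, quot_cast, quot_cast] at this
      exact_mod_cast this
    set d := quot (quot (T0 (src e)) (T0 (tgt e))) (quot (T1 (src e)) (T1 (tgt e))) with hd
    have ha : halfAngle T0 (src e) - halfAngle T0 (tgt e)
        = 2 * Real.arctan (quot (T0 (src e)) (T0 (tgt e))) := two_mul_arctan_sub hp0'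
    have hs : halfAngle T1 (src e) - halfAngle T1 (tgt e)
        = 2 * Real.arctan (quot (T1 (src e)) (T1 (tgt e))) := two_mul_arctan_sub hp1'
    have has : 2 * Real.arctan (quot (T0 (src e)) (T0 (tgt e)))
        - 2 * Real.arctan (quot (T1 (src e)) (T1 (tgt e))) = 2 * Real.arctan d :=
      two_mul_arctan_sub hpq'
    have hdle : |Real.arctan d| ≤ |d| := abs_arctan_le_abs d
    have hRs := hθR (src e)
    have hRt := hθR (tgt e)
    have habs : |(halfAngle T0 (src e) - halfAngle T0 (tgt e)) - (θ (src e) - θ (tgt e))|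
        ≤ 2 * (|d| + (C.R : ℝ)) := by
      have hsplit : (halfAngle T0 (src e) - halfAngle T0 (tgt e)) - (θ (src e) - θ (tgt e))
          = 2 * Real.arctan d + ((halfAngle T1 (src e) - θ (src e)) - (halfAngle T1 (tgt e) - θ (tgt e))) := by
        rw [ha, ← has, ← hs]; ring
      rw [hsplit]
      have hx : |halfAngle T1 (src e) - θ (src e)| < (C.R : ℝ) := by rw [abs_sub_comm]; exact hRs
      have hy : |halfAngle T1 (tgt e) - θ (tgt e)| < (C.R : ℝ) := by rw [abs_sub_comm]; exact hRt
      calc |2 * Real.arctan d + ((halfAngle T1 (src e) - θ (src e)) - (halfAngle T1 (tgt e) - θ (tgt e)))|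
          ≤ |2 * Real.arctan d| + |(halfAngle T1 (src e) - θ (src e)) - (halfAngle T1 (tgt e) - θ (tgt e))| :=
            abs_add_le _ _
        _ ≤ 2 * |d| + ((C.R : ℝ) + (C.R : ℝ)) := by
            refine add_le_add ?_ ?_
            · rw [abs_mul, abs_of_pos (by norm_num : (0 : ℝ) < 2)]; linarith
            · exact (abs_sub _ _).trans (by linarith)
        _ = 2 * (|d| + (C.R : ℝ)) := by ring
    have hy0 : 0 ≤ 2 * (|d| + (C.R : ℝ)) := by
      have : (0 : ℝ) ≤ (C.R : ℝ) := by exact_mod_cast hR.le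
      positivity
    have hsq : ((halfAngle T0 (src e) - halfAngle T0 (tgt e)) - (θ (src e) - θ (tgt e))) ^ 2
        ≤ (2 * (|d| + (C.R : ℝ))) ^ 2 := by
      obtain ⟨hl, hu⟩ := abs_le.mp habs
      exact sq_le_sq' hl hu
    simp only [hF]
    nlinarith
  -- step 4: the rational budget
  have h4 : ∑ e, W1 e * (2 * (|quot (quot (T0 (src e)) (T0 (tgt e)))
      (quot (T1 (src e)) (T1 (tgt e)))| + (C.R : ℝ)) ^ 2) ≤ (C.c : ℝ) := by
    have := (Rat.cast_le (K := ℝ)).2 hener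
    push_cast at this
    simp_rw [quot_cast] at this
    exact this
  calc p.potential θ (halfAngle T0) ≤ 1 / 2 * ∑ i, ∑ j, p.b i j * F i j := h1
    _ = ∑ e, W1 e * F (src e) (tgt e) := h2
    _ ≤ ∑ e, W1 e * (2 * (|quot (quot (T0 (src e)) (T0 (tgt e)))
          (quot (T1 (src e)) (T1 (tgt e)))| + (C.R : ℝ)) ^ 2) := Finset.sum_le_sum fun e _ => h3 e
    _ ≤ (C.c : ℝ) := h4

end Budget

/-! ### Re-synchronisation after the switch -/

section Resync

variable {src tgt : Fin m → Fin n} {w0 w1 : Fin m → ℚ} {t0 : Fin n → ℚ} {r : Fin n} {C : Cert n m}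

/-- **RE-SYNCHRONISATION AFTER A SWITCH (MODEL MV-3, simulation-free).** Data: an edge list with
pre-switch weights `w0`, post-switch weights `w1`, pre-switch synchronous half-angle point
`δ₀ = halfAngle t0`, reference node `r`, a certificate `C` passing `C.check`; well-formed post-switch
structure-preserving data `p` on `n ≠ 0` nodes with `p.b = symmetrize (edgeWeight src tgt w1)` and the
KEPT injections `p.P0ᵢ = f⁰ᵢ(δ₀)`; an exact synchronous angle vector `θ` of `p` (`fᵢ(θ) = P⁰ᵢ` at every
node) within `R` of the certificate's half-angle point and with every coupled branch inside
`2·arctan τγ` (such a `θ` EXISTS: `exists_equilibrium_of_check`). CLAIM: every solution `δ` of the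
post-switch model AS PRINTED (model-2's `IsSolution`, all `t`) that starts at the pre-switch
synchronous state — `δ(0) = δ₀`, `δ̇ᵢ(0) = 0` at every generator — satisfies for all `t ≥ 0`:
Vu–Turitsyn's polytope `|(δᵢ(t) − δⱼ(t)) + (θᵢ − θⱼ)| < π` on coupled pairs and `V(θ; δ(t), δ̇(t)) ≤ c`;
and it RE-SYNCHRONISES: `δ(t) → θ + κ·1` with `κ = Σᵢ Dᵢ(δ₀ᵢ − θᵢ)/Σᵢ Dᵢ` (the representative of the
post-switch equilibrium on the momentum leaf of the initial state) and `δ̇ᵢ(t) → 0` at every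
generator. Proof: `tendsto_of_isSolution_vt` for the rotated equilibrium `θ + κ·1` (same couplings,
energy, polytope), with `ω₀ = 0` (the kept injections sum to zero), connectivity from
`preconnected_of_coercive`, the per-edge level from `levelFactor_le_vtGap`, the initial energy from
`potential_pre_le_of_check` (zero kinetic part), and the leaf identity `L(δ₀, 0) = L(θ + κ·1, 0)`.
[cite: VuTuritsyn2016, §IV and §VI; Padiyar2013, §3.2 Remark 2] -/
theorem resync_of_check (hchk : C.check src tgt w0 w1 t0 r) (hn : n ≠ 0) {p : Params n}
    (hp : p.WellFormed) (hb : p.b = symmetrize (edgeWeight src tgt fun e => (w1 e : ℝ)))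
    (hP0 : ∀ i, p.P0 i = flowQ src tgt (fun e => (w0 e : ℝ)) (fun i => (t0 i : ℝ)) i)
    {θ : Fin n → ℝ} (hθeq : ∀ i, p.pe θ i = p.P0 i)
    (hθR : ∀ i, |θ i - halfAngle (fun i => (C.t1 i : ℝ)) i| < (C.R : ℝ))
    (hθγ : ∀ i j, i ≠ j → p.b i j ≠ 0 → |θ i - θ j| < 2 * Real.arctan (C.τγ : ℝ))
    {δ : ℝ → Fin n → ℝ} (hδ : p.IsSolution δ) (hδ0 : δ 0 = halfAngle fun i => (t0 i : ℝ))
    (hv0 : ∀ i ∈ p.gen, deriv (fun u => δ u i) 0 = 0) :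
    (∀ t, 0 ≤ t →
        (∀ i j, p.b i j ≠ 0 → |(δ t i - δ t j) + (θ i - θ j)| < π) ∧
          p.energy θ (δ t) (fun i => deriv (fun u => δ u i) t) ≤ (C.c : ℝ)) ∧
      Tendsto δ atTop
        (𝓝 fun i => θ i + (∑ j, p.D j * (halfAngle (fun i => (t0 i : ℝ)) j - θ j)) / ∑ j, p.D j) ∧
      ∀ i ∈ p.gen, Tendsto (fun t => deriv (fun u => δ u i) t) atTop (𝓝 0) := by
  have hchk' := hchk
  obtain ⟨⟨hR, hμ, hτ1, hτ1γ, hτγ1, -⟩, hedge, hnode, -, -⟩ := hchk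
  set W1 : Fin m → ℝ := fun e => (w1 e : ℝ) with hW1
  set W0 : Fin m → ℝ := fun e => (w0 e : ℝ) with hW0
  set T1 : Fin n → ℝ := fun i => (C.t1 i : ℝ) with hT1
  set T0 : Fin n → ℝ := fun i => (t0 i : ℝ) with hT0
  have hW1nn : ∀ e, 0 ≤ W1 e := fun e => by simp only [hW1]; exact_mod_cast (hedge e).2.1
  have hbs : ∀ i j, p.b i j = p.b j i := fun i j => by rw [hb]; exact symmetrize_symm _ i j
  have hbnn : ∀ i j, 0 ≤ p.b i j := fun i j => by
    rw [hb]; exact symmetrize_nonneg (edgeWeight_nonneg hW1nn) i j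
  have hτγ0 : (0 : ℝ) ≤ (C.τγ : ℝ) := by exact_mod_cast hτ1.trans hτ1γ
  have hτγ1' : (C.τγ : ℝ) < 1 := by exact_mod_cast hτγ1
  have hγlt : 2 * Real.arctan (C.τγ : ℝ) < π / 2 := two_mul_arctan_lt_pi_div_two hτγ1'
  have hc₀nn : (0 : ℝ) ≤ hcos (C.τγ : ℝ) := by
    unfold hcos
    apply div_nonneg <;> nlinarith
  -- the kept injections sum to zero; the model is its own shifted model
  have hsumP : ∑ i, p.P0 i = 0 := by
    simp_rw [hP0, ← pe_halfAngle_eq_flowQ]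
    exact ClassicalModel.flow_sum_eq_zero _ (fun i j => symmetrize_symm _ i j) _
  have hshift : p.shifted = p := shifted_eq_self_of_sum_P0 p hsumP
  have hPbar : ∀ i, p.Pbar i = p.P0 i := fun i => by
    have := congrArg (fun q : Params n => q.P0 i) hshift
    simpa using this
  -- the rotated equilibrium on the leaf of the initial state
  set κ : ℝ := (∑ j, p.D j * (halfAngle T0 j - θ j)) / ∑ j, p.D j with hκ
  set θ' : Fin n → ℝ := fun i => θ i + κ with hθ'
  have hθ'eq : p.IsSyncEquilibrium θ' := by
    have hθsync : p.IsSyncEquilibrium θ := fun i => by rw [hPbar]; exact hθeq i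
    exact isSyncEquilibrium_add_const p hθsync κ
  have hdiff : ∀ i j, θ' i - θ' j = θ i - θ j := fun i j => by simp only [hθ']; ring
  -- no self-loops: the diagonal couplings vanish
  have hdiag : ∀ i, p.b i i = 0 := fun i => by
    rw [hb]; exact symmetrize_edgeWeight_self src tgt W1 (fun e => (hedge e).2.2.1) i
  have h0' : ∀ i j, p.b i j ≠ 0 → |θ' i - θ' j| < π / 2 := by
    intro i j hij
    rw [hdiff]
    by_cases h : i = j
    · subst h; simp [Real.pi_pos]
    · exact (hθγ i j h hij).trans hγlt
  -- connectivity from coercivity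
  have hsup : ∀ i, i ≠ r → (C.μ : ℝ) * (C.x i : ℝ)
      ≤ hcos (C.τγ : ℝ) * lapQ src tgt W1 (fun j => (C.x j : ℝ)) i := by
    intro i hi
    have := (Rat.cast_le (K := ℝ)).2 ((hnode i).2 hi)
    rw [Rat.cast_mul, Rat.cast_mul, hcos_cast, lapQ_cast] at this
    exact this
  have hcoer := coercive_of_lapQ src tgt W1 hW1nn r hc₀nn (fun j => (C.x j : ℝ))
    (fun i => by exact_mod_cast (hnode i).1) hsup
  have hconn : p.couplingGraph.Preconnected := by
    refine preconnected_of_coercive p hbs r (μ := (C.μ : ℝ)) (c₀ := hcos (C.τγ : ℝ))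
      (by exact_mod_cast hμ) fun v hv => ?_
    have := hcoer v hv
    rw [hb]
    exact this
  -- the per-edge level
  have hc' : ∀ i j, p.b i j ≠ 0 → (C.c : ℝ) < p.b i j
      * ClassicalModel.LosslessSystem.vtGap (θ' i - θ' j) := by
    intro i j hij
    by_cases h : i = j
    · subst h; exact absurd (hdiag i) hij
    rw [hdiff]
    have hij' : symmetrize (edgeWeight src tgt W1) i j ≠ 0 := by rw [← hb]; exact hij
    obtain ⟨e, hwe, hor⟩ := exists_ne_zero_edge src tgt W1 hij'
    have hwe' : w1 e ≠ 0 := fun h => hwe (by simp [hW1, h])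
    obtain ⟨-, -, -, -, -, hlev⟩ := (hedge e).2.2.2.resolve_left hwe'
    have hlev' : (C.c : ℝ) < W1 e * (2 * hcos (C.τγ : ℝ) - 3141593 / 1000000 * hsin (C.τγ : ℝ)) := by
      have := (Rat.cast_lt (K := ℝ)).2 hlev
      rw [Rat.cast_mul, Rat.cast_sub, Rat.cast_mul, Rat.cast_mul, hcos_cast, hsin_cast] at this
      push_cast at this
      exact this
    have hwpos : 0 < W1 e := lt_of_le_of_ne (hW1nn e) (Ne.symm hwe)
    have hfac_pos : 0 < 2 * hcos (C.τγ : ℝ) - 3141593 / 1000000 * hsin (C.τγ : ℝ) := by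
      by_contra hneg
      have hneg := not_lt.mp hneg
      have hc0 : (0 : ℝ) < (C.c : ℝ) := by
        have hRpos : (0 : ℚ) < C.R := hR
        obtain ⟨-, -, -, -, hener⟩ := hchk'
        have h0 : (0 : ℚ) ≤ ∑ e, w1 e * (2 * (|quot (quot (t0 (src e)) (t0 (tgt e)))
            (quot (C.t1 (src e)) (C.t1 (tgt e)))| + C.R) ^ 2) :=
          Finset.sum_nonneg fun e _ => mul_nonneg (hedge e).2.1 (by positivity)
        have hwpos' : (0 : ℚ) < w1 e := lt_of_le_of_ne (hedge e).2.1 (Ne.symm hwe')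
        have hterm : (0 : ℚ) < w1 e * (2 * (|quot (quot (t0 (src e)) (t0 (tgt e)))
            (quot (C.t1 (src e)) (C.t1 (tgt e)))| + C.R) ^ 2) :=
          mul_pos hwpos' (by positivity)
        have hle := Finset.single_le_sum (f := fun e => w1 e * (2 * (|quot (quot (t0 (src e)) (t0 (tgt e)))
            (quot (C.t1 (src e)) (C.t1 (tgt e)))| + C.R) ^ 2))
          (fun e _ => mul_nonneg (hedge e).2.1 (by positivity)) (Finset.mem_univ e)
        have : (0 : ℚ) < C.c := lt_of_lt_of_le (lt_of_lt_of_le hterm hle) hener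
        exact_mod_cast this
      have : W1 e * (2 * hcos (C.τγ : ℝ) - 3141593 / 1000000 * hsin (C.τγ : ℝ)) ≤ 0 :=
        mul_nonpos_of_nonneg_of_nonpos hwpos.le hneg
      linarith
    have hbge : W1 e ≤ p.b i j := by
      rw [hb]
      rcases hor with ⟨hs, ht⟩ | ⟨hs, ht⟩
      · exact (le_edgeWeight_of_edge hW1nn e hs ht).trans
          (le_symmetrize_left (edgeWeight_nonneg hW1nn) i j)
      · exact (le_edgeWeight_of_edge hW1nn e hs ht).trans
          (le_symmetrize_right (edgeWeight_nonneg hW1nn) i j)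
    have hgap : 2 * hcos (C.τγ : ℝ) - 3141593 / 1000000 * hsin (C.τγ : ℝ)
        ≤ ClassicalModel.LosslessSystem.vtGap (θ i - θ j) :=
      levelFactor_le_vtGap hτγ0 hτγ1' (hθγ i j h hij).le
    calc (C.c : ℝ) < W1 e * (2 * hcos (C.τγ : ℝ) - 3141593 / 1000000 * hsin (C.τγ : ℝ)) := hlev'
      _ ≤ p.b i j * (2 * hcos (C.τγ : ℝ) - 3141593 / 1000000 * hsin (C.τγ : ℝ)) :=
          mul_le_mul_of_nonneg_right hbge hfac_pos.le
      _ ≤ p.b i j * ClassicalModel.LosslessSystem.vtGap (θ i - θ j) :=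
          mul_le_mul_of_nonneg_left hgap (hbnn i j)
  -- the initial state: polytope, leaf, energy
  have hsol : p.shifted.IsSolution δ := by rw [hshift]; exact hδ
  have hpol : ∀ i j, p.b i j ≠ 0 → |(δ 0 i - δ 0 j) + (θ' i - θ' j)| < π := by
    intro i j hij
    by_cases h : i = j
    · subst h; exact absurd (hdiag i) hij
    rw [hdiff, hδ0]
    have hij' : symmetrize (edgeWeight src tgt W1) i j ≠ 0 := by rw [← hb]; exact hij
    obtain ⟨e, hwe, hor⟩ := exists_ne_zero_edge src tgt W1 hij'
    have hwe' : w1 e ≠ 0 := fun h => hwe (by simp [hW1, h])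
    obtain ⟨-, -, hp0, hq0, -, -⟩ := (hedge e).2.2.2.resolve_left hwe'
    have hp0' : (-1 : ℝ) < T0 (src e) * T0 (tgt e) := by simp only [hT0]; exact_mod_cast hp0
    have hq0' : |(T0 (src e) - T0 (tgt e)) / (1 + T0 (src e) * T0 (tgt e))| ≤ (1 : ℝ) := by
      have := (Rat.cast_le (K := ℝ)).2 hq0
      rw [Rat.cast_abs, quot_cast, Rat.cast_one] at this
      exact this
    have hpre : |halfAngle T0 i - halfAngle T0 j| ≤ 2 * Real.arctan 1 := by
      rcases hor with ⟨hs, ht⟩ | ⟨hs, ht⟩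
      · subst hs; subst ht; exact abs_halfAngle_sub_le hp0' hq0'
      · subst hs; subst ht; rw [abs_sub_comm]; exact abs_halfAngle_sub_le hp0' hq0'
    rw [Real.arctan_one] at hpre
    have hpost := (hθγ i j h hij).trans hγlt
    calc |(halfAngle T0 i - halfAngle T0 j) + (θ i - θ j)|
        ≤ |halfAngle T0 i - halfAngle T0 j| + |θ i - θ j| := abs_add_le _ _
      _ < 2 * (π / 4) + π / 2 := by linarith
      _ = π := by ring
  have hDsum : 0 < ∑ j, p.D j := sum_D_pos hp hn
  have hL : p.momentum (δ 0) (fun i => deriv (fun u => δ u i) 0) = p.momentum θ' 0 := by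
    unfold Params.momentum
    have hk : ∑ i ∈ p.gen, p.M i * deriv (fun u => δ u i) 0 = 0 :=
      Finset.sum_eq_zero fun i hi => by rw [hv0 i hi, mul_zero]
    rw [hk, hδ0, zero_add]
    simp only [Pi.zero_apply, mul_zero, Finset.sum_const_zero, zero_add, hθ']
    simp_rw [mul_add, Finset.sum_add_distrib, ← Finset.sum_mul]
    rw [hκ, mul_div_cancel₀ _ hDsum.ne']
    simp_rw [mul_sub, Finset.sum_sub_distrib]
    ring
  have hV : p.energy θ' (δ 0) (fun i => deriv (fun u => δ u i) 0) ≤ (C.c : ℝ) := by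
    rw [show θ' = fun i => θ i + κ from rfl, energy_add_const]
    unfold Params.energy
    have hk : p.kinetic (fun i => deriv (fun u => δ u i) 0) = 0 := by
      unfold Params.kinetic
      rw [Finset.sum_eq_zero fun i hi => by simp [hv0 i hi], mul_zero]
    rw [hk, zero_add, hδ0]
    exact potential_pre_le_of_check hchk' hb hθR
  obtain ⟨hstay, hlim, hfreq⟩ :=
    tendsto_of_isSolution_vt hp hn hconn hbnn h0' hθ'eq hc' hsol hpol hL hV
  refine ⟨fun t ht => ⟨fun i j hij => ?_, ?_⟩, hlim, hfreq⟩
  · have := (hstay t ht).1 i j hij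
    rwa [hdiff] at this
  · have := (hstay t ht).2
    rwa [show θ' = fun i => θ i + κ from rfl, energy_add_const] at this

end Resync

/-! ### Existence and re-synchronisation in one statement -/

section Packaged

variable {src tgt : Fin m → Fin n} {w0 w1 : Fin m → ℚ} {t0 : Fin n → ℚ} {r : Fin n} {C : Cert n m}

/-- **THE SWITCHING THEOREM (existence + re-synchronisation), MODEL MV-3.** For well-formed
post-switch structure-preserving data `p` on `n ≠ 0` nodes whose couplings are the edge-list couplings
of `w1` and whose injections are the KEPT pre-switch injections `f⁰(δ₀)` (`δ₀ = halfAngle t0`), a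
certificate passing `C.check` gives: a synchronous angle vector `θ` of `p` (all `n` power-flow
equations `fᵢ(θ) = P⁰ᵢ` exactly), pinned at the reference node to the certificate's half-angle point
and within `R` of it at every node, every coupled branch inside `2·arctan τγ < π/2`; and for EVERY
solution of `p` as printed starting at the pre-switch synchronous state (`δ(0) = δ₀`, zero generator
frequency deviations): the polytope and `V(θ; ·) ≤ c` for all `t ≥ 0`, `δ(t) → θ + κ·1`
(`κ = Σ Dᵢ(δ₀ᵢ − θᵢ)/Σ Dᵢ`), and `δ̇ᵢ(t) → 0` at every generator. No sentence here says a grid is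
stable or N−1 secure: a theorem about MODEL MV-3 under a switching without fault.
[cite: VuTuritsyn2016, §IV, §VI; DvijothamLowChertkov2015, §3.3 Corollary 1] -/
theorem switch_resync_of_check (hchk : C.check src tgt w0 w1 t0 r) (hn : n ≠ 0) {p : Params n}
    (hp : p.WellFormed) (hb : p.b = symmetrize (edgeWeight src tgt fun e => (w1 e : ℝ)))
    (hP0 : ∀ i, p.P0 i = flowQ src tgt (fun e => (w0 e : ℝ)) (fun i => (t0 i : ℝ)) i) :
    ∃ θ : Fin n → ℝ,
      θ r = halfAngle (fun i => (C.t1 i : ℝ)) r ∧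
      (∀ i, |θ i - halfAngle (fun i => (C.t1 i : ℝ)) i| < (C.R : ℝ)) ∧
      (∀ i, p.pe θ i = p.P0 i) ∧
      (∀ i j, i ≠ j → p.b i j ≠ 0 → |θ i - θ j| < 2 * Real.arctan (C.τγ : ℝ)) ∧
      ∀ δ : ℝ → Fin n → ℝ, p.IsSolution δ → δ 0 = halfAngle (fun i => (t0 i : ℝ)) →
        (∀ i ∈ p.gen, deriv (fun u => δ u i) 0 = 0) →
        (∀ t, 0 ≤ t →
            (∀ i j, p.b i j ≠ 0 → |(δ t i - δ t j) + (θ i - θ j)| < π) ∧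
              p.energy θ (δ t) (fun i => deriv (fun u => δ u i) t) ≤ (C.c : ℝ)) ∧
          Tendsto δ atTop
            (𝓝 fun i => θ i + (∑ j, p.D j * (halfAngle (fun i => (t0 i : ℝ)) j - θ j)) / ∑ j, p.D j) ∧
          ∀ i ∈ p.gen, Tendsto (fun t => deriv (fun u => δ u i) t) atTop (𝓝 0) := by
  obtain ⟨θ, hr, hball, heq, hcoh⟩ := exists_equilibrium_of_check hchk
  have heq' : ∀ i, p.pe θ i = p.P0 i := fun i => by
    rw [Params.pe, hb, heq i, hP0 i]
  have hcoh' : ∀ i j, i ≠ j → p.b i j ≠ 0 → |θ i - θ j| < 2 * Real.arctan (C.τγ : ℝ) :=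
    fun i j hij hne => hcoh i j hij (by rw [← hb]; exact hne)
  exact ⟨θ, hr, hball, heq', hcoh', fun δ hδ hδ0 hv0 =>
    resync_of_check hchk hn hp hb hP0 heq' hball hcoh' hδ hδ0 hv0⟩

end Packaged

end Summit.Ventures.GridStability.Lyapunov.StructurePreserving.Switch

end
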